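import Summits.QuantumFields.YangMills.Theorems.Y2BridgeClay
import Summits.QuantumFields.YangMills.Theorems.BalabanLadderIRCofinalCouplingsGrowth
import Summits.QuantumFields.YangMills.Theorems.BalabanLadderIRCofinalCouplingsRope
import HarnessLib

/-!
# `BalabanLadder.IR` (stmt-QuantumFields-19354), ideator line `cofinal-leaf` — support 3/4:
# the summit bridge consumes the IR leg only on a COFINAL SET OF COUPLINGS

Support file for the crux item stmt-QuantumFields-19354 (`Summit.QuantumFields.YangMills.Theses.BalabanLadder.IR`),
ideator seat `ym-ir-idea-12` (lens «wuc» = weakest unknown consequence, generation 2).  HONEST FRAMING: nothing here is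
asserted about Yang–Mills — every binder is a HYPOTHESIS about lattice Yang–Mills taken verbatim from the tree; the Clay
statement `YangMills` is NOT proved by any of this (R4 closes only the conditional finite-𝕋⁴ rung `BalabanLadder.UV`).

WHAT.  `Y2Bridge.osDataWithGap_of_legs_germ` / `…_of_legs` / `yangMills_of_legs` (`Theorems/Y2BridgeClay.lean`) with the
IR binder `IR G r a = GapInUnits G r a` (clustering at rate `c₁ a(β)` for ALL `β ≥ β₂`) replaced by the SAME family of
bounds on an arbitrary COFINAL SET OF COUPLINGS `Bset ⊆ ℝ` (`∀ x, ∃ β ∈ Bset, x ≤ β`; one rate `c₁`, species constants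
uniform over `Bset`; the body of `GapInUnits` with the binder `β ∈ Bset →`, written out — no new definition):
* `osDataWithGap_of_legs_germ_onCouplings`, `osDataWithGap_of_cofinalLegs` — OS data with both gaps at one group;
* `yangMills_of_cofinalLegs : (∀ G simple, ∃ r a, a > 0 ∧ a → 0 ∧ UV ∧ NT ∧ (∃ Bset cofinal, GapInUnits on Bset) ∧ ROT)
  → YangMills` — conclusion the tree's `_root_.YangMills` literally;
* `gapOn_univ_of_gapInUnits`, `gapOn_mono` — `Bset = univ` is the tree's `GapInUnits` (the tree bridge `yangMills_of_legs` is the case `Bset = univ`; not restated).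
Proof: the tree bridge verbatim, with `stub_rope ↦ stub_rope_onCouplings` (support 2/4) and
`stub_growth ↦ softLegs_joint_growth_onCouplings` (support 1/4); no other line changes.

WHY (the consequence for the crux).  The leaf `BalabanLadder.IR` is typed `LowerBounds → GapInUnits` with
`∀ β ≥ β₂`; the deciding theorem of the spine only ever uses it through this bridge, hence only on a cofinal set of
couplings.  The weakest consequence of `IR` that still decides the summit is therefore the COFINAL LEAF
(`LowerBounds → ∃ Bset cofinal, GapInUnits on Bset`), and a bill for it needs NO transport along the coupling axis
(the K2 `ExitScaleTameSC` / LIP `DefectLipschitzSC` conjunct of lines `coupling-clopen` / `lipschitz-chain`): cofinally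
many exiting couplings (K1 `ExitsUnboundedAt (1/24)`) + the AF pin X + the flux-sector residual suffice (support 4/4).
Re-typing the leaf is the route owner's decision; this file only certifies that the re-typed leaf closes.

References: K. Osterwalder, E. Seiler, Ann. Phys. 110 (1978) 440–471; J. Glimm, A. Jaffe, Quantum Physics (1987) §6.1,
§19.7; the tree files above. [folklore]
-/

set_option autoImplicit false

noncomputable section

open scoped SchwartzMap ComplexConjugate BigOperators
open MeasureTheory Filter Topology
open Literature.MathematicalPhysics.QuantumFieldTheory Literature.MathematicalPhysics.QuantumLattice
open Literature.MathematicalPhysics.AQFT Literature.Probability.LatticeModels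
open Summit.QuantumFields.YangMills.Cruxes.OSLegsFromFemtoAndGap.DlrCollarTransfer
open Summit.QuantumFields.YangMills.Cruxes.OSLegsAtWeakCouplingC.Sketch
open Summit.QuantumFields.YangMills.Theorems.OSLegsFromFemtoAndGap
  (isHermitian_of_isReflectionPositive latticeDist softLegs_joint_growth_onCouplings)
open Summit.QuantumFields.YangMills.Theorems.HypercubicLimit.Negative (onlySpecies latticeSchwinger_onlySpecies_self)
open Summit.QuantumFields.YangMills.Theorems.NPointIsotropy.Negative (E4)

namespace Summit.QuantumFields.YangMills.Cruxes.OSLegsAtWeakCouplingC.Y2Bridge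

/-! ## The bridge at one gauge group, IR on a cofinal set of couplings -/

section OneGroup

variable {G : Type} [Group G] [TopologicalSpace G] [IsTopologicalGroup G] [CompactSpace G]
  [MeasurableSpace G] [BorelSpace G]

/-- `GapInUnits` is its own restriction to `Set.univ` (so every theorem below specialises to the tree bridge). -/
theorem gapOn_univ_of_gapInUnits (r : LatticeRep G) (a : ℝ → ℝ) (h : GapInUnits G r a) :
    ∃ (c₁ β₂ : ℝ) (S₁ : ℝ → ℕ), 0 < c₁ ∧ ∀ A B : YMSpecies G, ∃ C : ℝ, ∀ β ∈ (Set.univ : Set ℝ), β₂ ≤ β →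
      ∀ S n : ℕ, S₁ β ≤ S → n ≤ S →
        |latticeConnectedCorr r.ρ β (2 * S + 1) A.F B.F n| ≤ C * Real.exp (-(c₁ * a β * n)) := by
  obtain ⟨c₁, β₂, S₁, hc₁, h⟩ := h
  refine ⟨c₁, β₂, S₁, hc₁, fun A B => ?_⟩
  obtain ⟨C, hC⟩ := h A B
  exact ⟨C, fun β _ hβ S n hS hn => hC β hβ S n hS hn⟩

/-- Restriction of a `GapInUnits`-type family to a smaller set of couplings. -/
theorem gapOn_mono (r : LatticeRep G) (a : ℝ → ℝ) {Bset Bset' : Set ℝ} (hsub : Bset' ⊆ Bset)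
    (h : ∃ (c₁ β₂ : ℝ) (S₁ : ℝ → ℕ), 0 < c₁ ∧ ∀ A B : YMSpecies G, ∃ C : ℝ, ∀ β ∈ Bset, β₂ ≤ β →
      ∀ S n : ℕ, S₁ β ≤ S → n ≤ S →
        |latticeConnectedCorr r.ρ β (2 * S + 1) A.F B.F n| ≤ C * Real.exp (-(c₁ * a β * n))) :
    ∃ (c₁ β₂ : ℝ) (S₁ : ℝ → ℕ), 0 < c₁ ∧ ∀ A B : YMSpecies G, ∃ C : ℝ, ∀ β ∈ Bset', β₂ ≤ β →
      ∀ S n : ℕ, S₁ β ≤ S → n ≤ S →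
        |latticeConnectedCorr r.ρ β (2 * S + 1) A.F B.F n| ≤ C * Real.exp (-(c₁ * a β * n)) := by
  obtain ⟨c₁, β₂, S₁, hc₁, h⟩ := h
  refine ⟨c₁, β₂, S₁, hc₁, fun A B => ?_⟩
  obtain ⟨C, hC⟩ := h A B
  exact ⟨C, fun β hβ' hβ S n hS hn => hC β (hsub hβ') hβ S n hS hn⟩

/-- **OS data with BOTH gaps from UV, NT, the IR family ON A COFINAL SET OF COUPLINGS, and ANY germ mechanism** — the
tree's `osDataWithGap_of_legs_germ` verbatim except that the rope is `stub_rope_onCouplings` and the soft bundle is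
extracted with all its couplings in `Bset` (`softLegs_joint_growth_onCouplings`). -/
theorem osDataWithGap_of_legs_germ_onCouplings (r : LatticeRep G) (a : ℝ → ℝ) (hapos : ∀ β, 0 < a β)
    (ha0 : Tendsto a atTop (𝓝 0)) (hUV : UV G r a) (hNT : NT G r a)
    (Bset : Set ℝ) (hBcof : ∀ x : ℝ, ∃ β ∈ Bset, x ≤ β)
    (hIRon : ∃ (c₁ β₂ : ℝ) (S₁ : ℝ → ℕ), 0 < c₁ ∧ ∀ A B : YMSpecies G, ∃ C : ℝ, ∀ β ∈ Bset, β₂ ≤ β →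
      ∀ S n : ℕ, S₁ β ≤ S → n ≤ S →
        |latticeConnectedCorr r.ρ β (2 * S + 1) A.F B.F n| ≤ C * Real.exp (-(c₁ * a β * n)))
    (hGERM : ∀ (sch : SpeciesScheme (YMSpecies G)) (S₁ : SchwingerFamily E4)
      (Tq : (n : ℕ) → (Fin n → Fin 4 × Fin 4) → (𝓢((Fin n → E4), ℂ) →L[ℂ] ℂ)) (K b₀ : ℝ) (g : ℝ → ℕ → ℕ),
      SoftBundle G r a sch S₁ Tq K b₀ g → OffDiagDensity S₁ →
        ∃ r₁ : ℝ, 0 < r₁ ∧ ∀ R : E4 ≃ₗᵢ[ℝ] E4, LinearMap.det (R.toLinearEquiv : E4 →ₗ[ℝ] E4) = 1 →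
          IsPlanar01 R → GermInvariant S₁ R r₁) :
    ∃ (sch : SpeciesScheme (YMSpecies G)) (T : OSData (YMSpecies G) 4),
      (∀ k, sch.a k = a (sch.β k)) ∧ sch.HasWeakCouplingLimit ∧ IsYangMillsFor r sch T ∧
        T.IsNontrivial r.curvature ∧ T.IsNonGaussian r.curvature ∧
        ∃ Δ > 0, T.HasMassGap Δ ∧ HasLatticeMassGap r sch Δ := by
  -- the rope's demands, then the soft bundle meeting them (compactness + inheritance: `stub_growth`)
  -- the rope's demands (anchor read on `Bset` only), then the soft bundle meeting them WITH COUPLINGS IN `Bset`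
  obtain ⟨b₀, g, Δ, hΔ, hRD⟩ := stub_rope_onCouplings r a hapos ha0 Bset hIRon
  obtain ⟨sch, S₁, Tq, K, hB, hmem⟩ :=
    softLegs_joint_growth_onCouplings r hapos ha0 hUV hNT Bset hBcof hIRon b₀ g
  obtain ⟨hRP, hDec⟩ := hRD sch S₁ Tq K hB hmem
  have hsigned : ∀ R : E4 ≃ₗᵢ[ℝ] E4, IsSignedPerm R → Invariant S₁ R :=
    fun R hR n F hF => stub_hypercubic G r a sch S₁ Tq K b₀ g hB n R hR F hF
  have hdens : OffDiagDensity S₁ := stub_density G r a sch S₁ Tq K b₀ g hUV hB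
  -- unpack the bundle
  obtain ⟨⟨hunits, -, -, hβ, hN, hLG, hE3, htrans, h0, h1', -, -, hYM, hnt, hng, ⟨Δ', hΔ', hlat⟩, hranges, -⟩, -⟩ :=
    id hB
  -- E1: det-1 planar germ invariance (from the abstract mechanism) ⇒ planar invariance ⇒ SO(4)
  obtain ⟨r₁, hr₁, hgermR⟩ := hGERM sch S₁ Tq K b₀ g hB hdens
  -- continuum side
  obtain ⟨hCS, hgapOf⟩ := stub_gap S₁ h0 htrans hRP
  have hE4 : S₁.toLabelled.HasClusterProperty :=
    stub_cluster S₁ Δ hΔ h0 h1' htrans (fun n R hR F hF => hsigned R hR n F hF) hCS hDec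
  have hplanar : ∀ R : E4 ≃ₗᵢ[ℝ] E4, LinearMap.det (R.toLinearEquiv : E4 →ₗ[ℝ] E4) = 1 → IsPlanar01 R →
      Invariant S₁ R := fun R hdet hR =>
    stub_locality S₁ h0 htrans hE3 hLG hRP hsigned hdens R hR r₁ hr₁ (hgermR R hdet hR)
  have hE1 : S₁.toLabelled.IsEuclideanInvariant := isEuclideanInvariant_of_planarRot S₁ htrans hsigned hplanar
  have hE2 : S₁.toLabelled.IsReflectionPositive := isReflectionPositive_of_rpPos hRP
  have hherm : S₁.toLabelled.IsHermitian := isHermitian_of_isReflectionPositive S₁ hN hE2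
  have hOS : OSAxiomsSchwinger S₁.toLabelled :=
    { normalized := hN, hermitian := hherm, invariant := hE1, reflectionPositive := hE2, symmetric := hE3,
      cluster := hE4, linearGrowth := hLG }
  -- the continuum gap the tree derives and drops, and the common rate
  have hgap : S₁.toLabelled.HasMassGap Δ := hgapOf Δ hΔ hDec
  have hΔ₀ : 0 < min Δ Δ' := lt_min hΔ hΔ'
  have hgap₀ : S₁.toLabelled.HasMassGap (min Δ Δ') := hasMassGap_anti hgap (min_le_left _ _)
  have hlat₀ : HasLatticeMassGap r sch (min Δ Δ') := hasLatticeMassGap_anti r sch hlat (min_le_right _ _)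
  -- one OS field (species `Unit`), then extension by zero along the silenced scheme
  have hc : ∀ s : YMSpecies G, s ≠ r.curvature → ∀ k, (onlySpecies sch r.curvature).c s k = 0 := by
    intro s hs k
    simp [onlySpecies, hs]
  have hconv : ∀ n : ℕ, n ≠ 0 → ∀ (f : Fin n → 𝓢(E4, ℝ)) (F : 𝓢((Fin n → E4), ℂ)),
      IsTensorOf F (fun i => ofRealTest (f i)) → IsOffDiagonal F →
        Tendsto (fun k : ℕ => ((latticeSchwinger r.ρ (onlySpecies sch r.curvature) (fun s => s.F) k n
          (fun _ => r.curvature) f : ℝ) : ℂ)) atTop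
          (𝓝 ((OSData.ofAxioms S₁.toLabelled hOS).schwinger n (fun _ => ()) F)) := by
    intro n hn f F hF hod
    simp_rw [latticeSchwinger_onlySpecies_self]
    rw [OSData.ofAxioms_schwinger, SchwingerFamily.toLabelled_apply]
    exact hYM n hn f F hF hod
  have hNT' : (OSData.ofAxioms S₁.toLabelled hOS).IsNontrivial () := by
    unfold OSData.IsNontrivial
    simpa only [OSData.ofAxioms_schwinger] using hnt
  have hNG' : (OSData.ofAxioms S₁.toLabelled hOS).IsNonGaussian () := by
    unfold OSData.IsNonGaussian
    simpa only [OSData.ofAxioms_schwinger] using hng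
  have hgapT : (OSData.ofAxioms S₁.toLabelled hOS).HasMassGap (min Δ Δ') := by
    unfold OSData.HasMassGap
    simpa only [OSData.ofAxioms_schwinger] using hgap₀
  obtain ⟨T, hYM', hntT, hngT, Δ₁, hΔ₁, hgapT', hlatT⟩ :=
    exists_yangMillsWitness_of_oneSpecies r (onlySpecies sch r.curvature) hc (OSData.ofAxioms S₁.toLabelled hOS)
      hconv hNT' hNG' hΔ₀ hgapT hlat₀
  exact ⟨onlySpecies sch r.curvature, T, hunits, hβ, hYM', hntT, hngT, Δ₁, hΔ₁, hgapT', hlatT⟩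

/-- **OS data with BOTH gaps from `UV ∧ NT ∧ (IR on a cofinal set of couplings) ∧ ROT`.** -/
theorem osDataWithGap_of_cofinalLegs (r : LatticeRep G) (a : ℝ → ℝ) (hapos : ∀ β, 0 < a β)
    (ha0 : Tendsto a atTop (𝓝 0)) (hUV : UV G r a) (hNT : NT G r a)
    (Bset : Set ℝ) (hBcof : ∀ x : ℝ, ∃ β ∈ Bset, x ≤ β)
    (hIRon : ∃ (c₁ β₂ : ℝ) (S₁ : ℝ → ℕ), 0 < c₁ ∧ ∀ A B : YMSpecies G, ∃ C : ℝ, ∀ β ∈ Bset, β₂ ≤ β →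
      ∀ S n : ℕ, S₁ β ≤ S → n ≤ S →
        |latticeConnectedCorr r.ρ β (2 * S + 1) A.F B.F n| ≤ C * Real.exp (-(c₁ * a β * n)))
    (hROT : ROT G r a) :
    ∃ (sch : SpeciesScheme (YMSpecies G)) (T : OSData (YMSpecies G) 4),
      (∀ k, sch.a k = a (sch.β k)) ∧ sch.HasWeakCouplingLimit ∧ IsYangMillsFor r sch T ∧
        T.IsNontrivial r.curvature ∧ T.IsNonGaussian r.curvature ∧
        ∃ Δ > 0, T.HasMassGap Δ ∧ HasLatticeMassGap r sch Δ := by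
  refine osDataWithGap_of_legs_germ_onCouplings r a hapos ha0 hUV hNT Bset hBcof hIRon
    fun sch S₁ Tq K b₀ g hB hdens => ?_
  obtain ⟨⟨hunits, -, -, hβ, -, -, -, -, -, -, -, -, -, -, -, -, hranges, -⟩, -⟩ := id hB
  obtain ⟨r₀, hr₀, hW⟩ := hROT sch hunits hβ hranges
  exact germRotAt_of_latticeWardAt r a sch S₁ Tq K b₀ g hB hdens hr₀ hW

end OneGroup

/-! ## The bridge to the Clay decl from the COFINAL IR leg -/

/-- **`YangMills ⇐ UV ∧ NT ∧ IR♭ ∧ ROT` with the COFINAL IR leg `IR♭`** — for every compact simple `G` SOME `r`, SOME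
positive unit map `a → 0`, the legs `UV`, `NT`, `ROT` as in the tree bridge, and the `GapInUnits` family (one rate
`c₁`, species-uniform constants) on SOME cofinal set of couplings `Bset`.  Conclusion: the tree's `_root_.YangMills`
literally.  (With `Bset = univ` this is the tree's `yangMills_of_legs`.) -/
theorem yangMills_of_cofinalLegs
    (h : ∀ (G : Type) [Group G] [TopologicalSpace G] [IsTopologicalGroup G] [CompactSpace G],
      IsCompactSimpleLieGroup G → letI : MeasurableSpace G := borel G; haveI : BorelSpace G := ⟨rfl⟩;
      ∃ (r : LatticeRep G) (a : ℝ → ℝ), (∀ β, 0 < a β) ∧ Tendsto a atTop (𝓝 0) ∧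
        UV G r a ∧ NT G r a ∧
        (∃ Bset : Set ℝ, (∀ x : ℝ, ∃ β ∈ Bset, x ≤ β) ∧
          ∃ (c₁ β₂ : ℝ) (S₁ : ℝ → ℕ), 0 < c₁ ∧ ∀ A B : YMSpecies G, ∃ C : ℝ, ∀ β ∈ Bset, β₂ ≤ β →
      ∀ S n : ℕ, S₁ β ≤ S → n ≤ S →
        |latticeConnectedCorr r.ρ β (2 * S + 1) A.F B.F n| ≤ C * Real.exp (-(c₁ * a β * n))) ∧
        ROT G r a) :
    YangMills := by
  intro G _ _ _ _ hG
  letI : MeasurableSpace G := borel G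
  haveI : BorelSpace G := ⟨rfl⟩
  obtain ⟨r, a, hapos, ha0, hUV, hNT, ⟨Bset, hBcof, hIRon⟩, hROT⟩ := h G hG
  obtain ⟨sch, T, -, hβ, hYM, hnt, hng, Δ, hΔ, hgap, hlat⟩ :=
    osDataWithGap_of_cofinalLegs r a hapos ha0 hUV hNT Bset hBcof hIRon hROT
  exact ⟨r, sch, T, hβ, hYM, hnt, hng, Δ, hΔ, hgap, hlat⟩

end Summit.QuantumFields.YangMills.Cruxes.OSLegsAtWeakCouplingC.Y2Bridge

end
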